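import Literature.NumberTheory.EllipticCurves.LocalWeilPairingDuality
import Literature.NumberTheory.GaloisRepresentations.TateDualityCounting
import HarnessLib

/-!
# The level-`n` local Tate SELF-pairing `⟨x, y⟩_ι = ι(x ∪ₑ y) ∈ ℤ/n` on `H¹(F, E[n]|_{Γ_F})` and its perfectness

Topic `NumberTheory/EllipticCurves`; namespace `Literature.NumberTheory.EllipticCurves`. A thin layer over
`LocalWeilPairingDuality.lean`, which already holds, for an elliptic curve `W` over a field `K₀` of characteristic
`0`, an extension field `F ⊇ K₀` and a Weil pairing `e` on `E[n] = E(K̄₀)[n]` (existential shape of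
`WeierstrassCurve.exists_weilPairing`): the LOCAL WEIL DUAL MAP `weilDualLocalHom W n e … F : E[n] → Hom(E[n], μₙ(F̄))`
(`Γ_F`-equivariant `weilDualLocalHom_smul`, bijective `weilDualLocalHom_bijective`, iso `weilDualLocalIso`), the
comparison `μₙ(K̄₀)|_{Γ_F} ≅ μₙ(F̄)` (`muRestrictIso`), `cohomologyMap_muRestrictIso_weilCupProduct`
(`H²(μ-iso)(x ∪ₑ y) = x ∪_{ev} H¹(w)(y)`) and local Tate duality for `E[n]` as TRIVIAL KERNELS of the Weil cup product
(`eq_zero_of_forall_weilCupProduct_eq_zero(_right)`, from the tree's `localDuality_bijective`). Nothing of that is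
re-declared here. What this file ADDS (definitions with bodies and theorems; no named fact, no instance, no `sorry`):

* `torsionRestricted W F n` — the abbreviation `E[n]|_{Γ_F} := GaloisRep.restrictField F (W.torsionGaloisModule n)`
  (the module of the finite-level Kummer classes of (S5a) `PAdicHodge.expStarCoord_eq_zero_iff_kummer`; its `toTopRep`
  is `TopRep.res (absGaloisRestrict K₀ F) (W.torsionGaloisModule n).toTopRep` DEFINITIONALLY, `toTopRep_torsionRestricted`);
* `weilDualLocalMor` — the local Weil dual map as a MORPHISM of topological `Γ_F`-representations under the
  equivariance hypothesis only (no non-degeneracy), `= (weilDualLocalIso …).hom` when the latter is defined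
  (`weilDualLocalIso_hom`, `rfl`); `cohomologyMap_weilDualLocalMor_bijective`;
* **`levelTatePairing ι : H¹(F, E[n]|) →+ H¹(F, E[n]|) →+ ℤ/n`**, `⟨x, y⟩_ι := ι(x ∪_{ev} H¹(w) y)` — the tree's
  `ContinuousRep.dualityPairing` (evaluation cup product, then `ι : H²(Γ_F, μₙ(F̄)) → ℤ/n`) precomposed with `H¹` of
  the local Weil dual map: the `ℤ/n`-VALUED local Tate pairing of Kolyvagin/Kato descents (`ι = inv_F`), as an
  honest bi-additive map (the consumers downstream — the `ℤ_p`-valued limit pairing on `H¹(F, T_pW)` — need values,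
  not only kernels);
* `levelTatePairing_eq_iota_weilCupProduct` — `⟨x, y⟩_ι = ι(H²(μ-iso)(x ∪ₑ y))` for the restricted Weil cup product of
  `LocalWeilPairingDuality.lean` (any `F ⊇ K₀`; covariant naturality of the cup product);
* ★ `exists_levelTatePairing_bijective` — over a non-archimedean local field `F` of characteristic `0`, for SOME
  injective `ι` both adjoints of `⟨·,·⟩_ι` are bijective: the bijective-adjoints form of
  `eq_zero_of_forall_weilCupProduct_eq_zero(_right)` (the tree's `localDuality_bijective` at `E[n]|_{Γ_F}` composed
  with the bijection `H¹(w)`). The sequel files upgrade «some injective `ι`» to «every bijective `ι`», in particular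
  THE invariant map `Prop121vii.invLevel F n`, and prove the compatibility in `n` along `E[p^{k+1}] → E[p^k]`.

Brick K2 floor (a) of the hT₂ programme of crux K★ stmt-BirchSwinnertonDyer-22226 (memo `Summits/BirchSwinnertonDyer/
BirchSwinnertonDyer/Cruxes/StarredOptimalManinUnitFiveSeven/Lines/kato-lever-hT2-programme.md` §4). BSD is not proved by
any of this.

## References
* J.-P. Serre, *Galois Cohomology*, Springer 1997, II §5.2 Thm. 2. [SerreGaloisCohomology1997]
* J. S. Milne, *Arithmetic Duality Theorems*, 2nd ed. 2006, I Cor. 2.3, I §6 proof of Prop. 6.9. [MilneADT2006]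
* J. H. Silverman, *The Arithmetic of Elliptic Curves*, 2nd ed. 2009, III §8 Prop. 8.1. [SilvermanAEC2009]
* J. Neukirch, A. Schmidt, K. Wingberg, *Cohomology of Number Fields*, 2008, I §4 (1.4.2), (7.2.6).
  [NeukirchSchmidtWingberg2008]
-/

noncomputable section

open CategoryTheory Function Field
open Literature.NumberTheory.GaloisRepresentations
open Literature.NumberTheory.GaloisRepresentations.DiscreteGaloisModule (mu MuCarrier)

universe u

namespace Literature.NumberTheory.EllipticCurves

open _root_.WeierstrassCurve

-- cup products need `LocallyCompactSpace Γ_F`; `E[n]` finite — local instances as in `LocalWeilPairingDuality.lean`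
attribute [local instance] absoluteGaloisGroup_compactSpace
attribute [local instance] finite_geomTorsion_of_neZero

variable {K₀ : Type u} [Field K₀] (W : WeierstrassCurve K₀) [W.IsElliptic]
  (F : Type u) [Field F] [Algebra K₀ F] (n : ℕ) [NeZero n]

/-- **`E[n]|_{Γ_F}`**: `E[n](K̄₀)` as a discrete `Γ_F`-module, `Γ_F` acting through `absGaloisRestrict K₀ F`
(the module of the finite-level Kummer classes of (S5a) `PAdicHodge.expStarCoord_eq_zero_iff_kummer`).
[cite: SerreGaloisCohomology1997, II §1.1] -/
abbrev torsionRestricted : DiscreteGaloisModule F (geomTorsion W n) :=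
  GaloisRep.restrictField F (W.torsionGaloisModule n)

omit [W.IsElliptic] [NeZero n] in
/-- Unfolding `torsionRestricted`: `σ` acts as `absGaloisRestrict K₀ F σ`. [cite: SerreGaloisCohomology1997, II §1.1] -/
theorem torsionRestricted_apply_apply (σ : absoluteGaloisGroup F) (T : geomTorsion W n) :
    torsionRestricted W F n σ T = absGaloisRestrict K₀ F σ • T := rfl

omit [W.IsElliptic] [NeZero n] in
/-- The topological representation underlying `E[n]|_{Γ_F}` IS the restriction `TopRep.res (absGaloisRestrict K₀ F)`
of that of `E[n]` (definitionally) — the object on which `LocalWeilPairingDuality.lean` states the local Weil cup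
product. [cite: SerreGaloisCohomology1997, II §1.1] -/
theorem toTopRep_torsionRestricted :
    (torsionRestricted W F n).toTopRep =
      TopRep.res (absGaloisRestrict K₀ F : absoluteGaloisGroup F →* absoluteGaloisGroup K₀)
        (W.torsionGaloisModule n).toTopRep := rfl

variable (e : geomTorsion W n → geomTorsion W n → AlgebraicClosure K₀)
  (hμ : ∀ S T, e S T ^ n = 1)
  (hadd₁ : ∀ S₁ S₂ T, e (S₁ + S₂) T = e S₁ T * e S₂ T)
  (hadd₂ : ∀ S T₁ T₂, e S (T₁ + T₂) = e S T₁ * e S T₂)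
  (hgal : ∀ (σ : absoluteGaloisGroup K₀) (S T : geomTorsion W n), σ • e S T = e (σ • S) (σ • T))

/-! ### The local Weil dual map as a morphism (equivariance only) -/

include hgal in
/-- The local Weil dual map `weilDualLocalHom` as a MORPHISM of topological `Γ_F`-representations
`E[n]|_{Γ_F} ⟶ (E[n]|_{Γ_F})^D = Hom(E[n], μₙ(F̄))`, under Galois-equivariance of `e` only (no non-degeneracy:
the input of `cohomologyMap`; it is `(weilDualLocalIso …).hom` where that is defined, `weilDualLocalIso_hom`).
[cite: MilneADT2006, I §6, proof of Prop. 6.9] -/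
def weilDualLocalMor :
    (torsionRestricted W F n).toTopRep ⟶ ((torsionRestricted W F n).homRep (mu F n)).toTopRep :=
  TopRep.ofHom
    { toFun := weilDualLocalHom W n e hμ hadd₁ hadd₂ F
      map_add' := map_add _
      map_smul' := fun c T => map_zsmul _ c T
      cont := continuous_of_discreteTopology
      isIntertwining' := fun σ => ContinuousLinearMap.ext fun T =>
        weilDualLocalHom_smul W n e hμ hadd₁ hadd₂ F hgal σ T }

/-- Unfolding `weilDualLocalMor`. [cite: MilneADT2006, I §6, proof of Prop. 6.9] -/
@[simp] theorem weilDualLocalMor_hom_apply (T : geomTorsion W n) :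
    (weilDualLocalMor W F n e hμ hadd₁ hadd₂ hgal).hom T = weilDualLocalHom W n e hμ hadd₁ hadd₂ F T := rfl

/-! ### The level-`n` self-pairing `⟨x, y⟩_ι = ι(x ∪_{ev} H¹(w) y)` -/

/-- **The level-`n` local Tate self-pairing of `E[n]|_{Γ_F}`**: `⟨x, y⟩_ι := ι(x ∪_{ev} H¹(w)(y)) ∈ ℤ/n`, the tree's
`ContinuousRep.dualityPairing` (cup product for the evaluation pairing `E[n] × Hom(E[n], μₙ) → μₙ`, then
`ι : H²(Γ_F, μₙ(F̄)) → ℤ/n`) precomposed in the second variable with `H¹` of the local Weil dual map; for `ι = inv_F`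
this is the local Tate pairing `H¹(F, E[n]) × H¹(F, E[n]) → ℤ/n` of Kolyvagin's and Kato's descents.
[cite: MilneADT2006, I Cor. 2.3 and I §6, proof of Prop. 6.9] [cite: NeukirchSchmidtWingberg2008, (7.2.6)] -/
def levelTatePairing (ι : continuousCohomology 2 (mu F n).toTopRep →+ ZMod n) :
    continuousCohomology 1 (torsionRestricted W F n).toTopRep →+
      continuousCohomology 1 (torsionRestricted W F n).toTopRep →+ ZMod n :=
  AddMonoidHom.mk'
    (fun x => ((torsionRestricted W F n).dualityPairing (mu F n) ι x).comp
      (cohomologyMap (weilDualLocalMor W F n e hμ hadd₁ hadd₂ hgal) 1).hom.toLinearMap.toAddMonoidHom)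
    fun x x' => by
      refine AddMonoidHom.ext fun y => ?_
      simp only [map_add, AddMonoidHom.coe_comp, Function.comp_apply, AddMonoidHom.add_apply]

/-- Unfolding `levelTatePairing`: `⟨x, y⟩_ι = ι(x ∪_{ev} H¹(w) y)`. [cite: MilneADT2006, I Cor. 2.3 and I §6, proof of Prop. 6.9] -/
@[simp] theorem levelTatePairing_apply (ι : continuousCohomology 2 (mu F n).toTopRep →+ ZMod n)
    (x y : continuousCohomology 1 (torsionRestricted W F n).toTopRep) :
    levelTatePairing W F n e hμ hadd₁ hadd₂ hgal ι x y =
      (torsionRestricted W F n).dualityPairing (mu F n) ι x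
        ((cohomologyMap (weilDualLocalMor W F n e hμ hadd₁ hadd₂ hgal) 1).hom y) := rfl

/-! ### Over fields of characteristic `0`: comparison with the Weil cup product, perfectness -/

variable [CharZero F]

variable (hnondeg : ∀ T, (∀ S, e S T = 1) → T = 0)

/-- `(weilDualLocalIso …).hom` IS `weilDualLocalMor` (definitionally). [cite: MilneADT2006, I §6, proof of Prop. 6.9] -/
theorem weilDualLocalIso_hom :
    (weilDualLocalIso W n e hμ hadd₁ hadd₂ F hgal hnondeg).hom = weilDualLocalMor W F n e hμ hadd₁ hadd₂ hgal := rfl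

include hnondeg in
/-- **`H^q(Γ_F, w)` is bijective** for non-degenerate `e` over `F` of characteristic `0` (cohomology of the isomorphism
`weilDualLocalIso`, `continuousCohomologyEquivOfIso`). [cite: MilneADT2006, I §6, proof of Prop. 6.9] -/
theorem cohomologyMap_weilDualLocalMor_bijective (q : ℕ) :
    Bijective (cohomologyMap (weilDualLocalMor W F n e hμ hadd₁ hadd₂ hgal) q).hom := by
  rw [← weilDualLocalIso_hom W F n e hμ hadd₁ hadd₂ hgal hnondeg]
  exact (continuousCohomologyEquivOfIso (weilDualLocalIso W n e hμ hadd₁ hadd₂ F hgal hnondeg) q).bijective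

/-- **`⟨x, y⟩_ι = ι(H²(μ-iso)(x ∪ₑ y))`** for the restricted Weil cup product `x ∪ₑ y ∈ H²(Γ_F, μₙ(K̄₀)|_{Γ_F})` of
`LocalWeilPairingDuality.lean` carried to `H²(Γ_F, μₙ(F̄))` by `muRestrictIso` — over ANY extension field `F ⊇ K₀`
(adjoint/covariant naturality of the cup product; Milne I §6 "the cup-product is induced by the `e_m`-pairing").
[cite: NeukirchSchmidtWingberg2008, I §4 (1.4.2)] [cite: MilneADT2006, I §6, proof of Prop. 6.9] -/
theorem levelTatePairing_eq_iota_weilCupProduct [CharZero K₀] (ι : continuousCohomology 2 (mu F n).toTopRep →+ ZMod n)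
    (x y : continuousCohomology 1 (torsionRestricted W F n).toTopRep) :
    levelTatePairing W F n e hμ hadd₁ hadd₂ hgal ι x y =
      ι (cohomologyMap (muRestrictIso K₀ n F).hom 2
        (((weilContPairing W n e hμ hadd₁ hadd₂ hgal).restrict (absGaloisRestrict K₀ F)).cupProduct x y)) := by
  rw [levelTatePairing_apply, ContinuousRep.dualityPairing_apply]
  congr 1
  refine ((ContPairing.cupProduct_map
    ((weilContPairing W n e hμ hadd₁ hadd₂ hgal).restrict (absGaloisRestrict K₀ F))
    ((torsionRestricted W F n).evalPairing (mu F n)) (𝟙 _)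
    (weilDualLocalMor W F n e hμ hadd₁ hadd₂ hgal) (muRestrictIso K₀ n F).hom
    (fun _ _ => rfl) x y).trans ?_).symm
  exact congrArg (fun z => ((torsionRestricted W F n).evalPairing (mu F n)).cupProduct z
      (cohomologyMap (weilDualLocalMor W F n e hμ hadd₁ hadd₂ hgal) 1 y))
    (map_apply_of_id _ (fun _ => rfl) _ (fun _ => rfl) 1 x)

include hnondeg in
/-- ★ **Local Tate duality for `E[n]` over a non-archimedean local field `F ⊇ K₀` of characteristic `0`, as a
SELF-pairing with bijective adjoints**: for some injective `ι : H²(Γ_F, μₙ(F̄)) → ℤ/n` both adjoints of `⟨·,·⟩_ι`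
are bijective — the tree's PROVED `localDuality_bijective` (Serre II §5.2 Thm. 2 / Milne I Cor. 2.3) at the module
`E[n]|_{Γ_F}`, composed with the bijection `H¹(w)` (`cohomologyMap_weilDualLocalMor_bijective`); the bijective-adjoints
form of `eq_zero_of_forall_weilCupProduct_eq_zero(_right)`.
[cite: SerreGaloisCohomology1997, II §5.2 Thm. 2] [cite: MilneADT2006, I Cor. 2.3] -/
theorem exists_levelTatePairing_bijective [ValuativeRel F] [TopologicalSpace F] [IsNonarchimedeanLocalField F] :
    ∃ ι : continuousCohomology 2 (mu F n).toTopRep →+ ZMod n, Injective ι ∧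
      Bijective (levelTatePairing W F n e hμ hadd₁ hadd₂ hgal ι) ∧
      Bijective (levelTatePairing W F n e hμ hadd₁ hadd₂ hgal ι).flip := by
  obtain ⟨ι, hι, h1, h2⟩ :=
    localDuality_bijective F (torsionRestricted W F n) (fun T : geomTorsion W n => AddSubgroup.torsionBy.nsmul T)
  have hΦ := cohomologyMap_weilDualLocalMor_bijective W F n e hμ hadd₁ hadd₂ hgal hnondeg 1
  set Φ := (cohomologyMap (weilDualLocalMor W F n e hμ hadd₁ hadd₂ hgal) 1).hom with hΦdef
  set D := (torsionRestricted W F n).dualityPairing (mu F n) ι with hDdef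
  set L := levelTatePairing W F n e hμ hadd₁ hadd₂ hgal ι with hLdef
  let Φe := AddEquiv.ofBijective Φ.toLinearMap.toAddMonoidHom hΦ
  have hL : ∀ x y, L x y = D x (Φ y) := fun x y => rfl
  refine ⟨ι, hι, ⟨fun x x' hxx' => h1.1 ?_, fun g => ?_⟩, ?_⟩
  · refine AddMonoidHom.ext fun b => ?_
    obtain ⟨y, rfl⟩ := hΦ.2 b
    rw [← hL, ← hL, hxx']
  · obtain ⟨x, hx⟩ := h1.2 (g.comp Φe.symm.toAddMonoidHom)
    refine ⟨x, AddMonoidHom.ext fun y => ?_⟩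
    rw [hL, hx, AddMonoidHom.coe_comp, Function.comp_apply]
    exact congrArg g (Φe.symm_apply_apply y)
  · have hflip : ⇑L.flip = fun y => D.flip (Φ y) := by
      funext y
      exact AddMonoidHom.ext fun x => hL x y
    rw [hflip]
    exact h2.comp hΦ

end Literature.NumberTheory.EllipticCurves

end
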